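import Literature.Topology.FourManifolds.MorseHandleCollapseDetects
import Literature.Topology.FourManifolds.MilnorChartStableSet
import Literature.Topology.FourManifolds.LeftHandDiscSlab
import HarnessLib

/-!
# Detection data at the maxima of a nice Morse function: the chart collapse

Topic `Literature/Topology/FourManifolds`.  Companion to `MorseHandleCollapseDetects.lean`, whose
detection theorem `Cobordism.IsNiceMorseFunction.exists_map_collapse_ne_zero` consumes, at every
critical point `p` of index `k`, a `Cobordism.DetectionDatum` (a transverse disc datum on the
handlebody `U = {g < cutLevel n (k + 1)}` whose stratum meets `D_L(p)` exactly at `p`, with a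
collapse map).  For `k ≤ n` (`dim W = n + 1`) these are the right-hand disc data
(`HandleNormalDatum.nonempty_detectionDatum`).  In the **top degree `k = n + 1`** the right-hand
disc of a maximum `p` is the point `p` itself, and the datum is simply a chart: in a Milnor box
about `p` (Milnor, *Lectures on the h-cobordism theorem* (1965), Def. 3.1 (2): coordinates with
`g = g(p) - |x⃗|²`, `ξ = -x⃗`, all coordinates contracting at a maximum) the stratum is `{p}`, the
normal coordinate is the (clipped) centred chart `u ↦ φ u - φ p ∈ ℝⁿ⁺¹`, the transverse disc is
the chart inverse on a small ball, and the stable set `D_L(p)` of `p` contains the whole box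
(proof of Thm. 3.12: *"this trajectory is a straight line segment tending to the origin"*,
`mem_stableSet_of_chart_milnorModelField`), so that the disc is a neighbourhood of `p` in it.
The collapse of this datum is the classical degree-one collapse `X → Sⁿ⁺¹` of the complement of
a ball (Thom 1954, Ch. II).

* `Cobordism.IsNiceMorseFunction.nonempty_detectionDatum_top` — detection data exist at every
  critical point of index `n + 1`;
* `Cobordism.IsNiceMorseFunction.nonempty_detectionDatum` — hence at every critical point of
  index `1 ≤ k ≤ n + 1` (with the case `k ≤ n` of `MorseHandleCollapseDetects.lean`).

Everything is proved; the only definition is the explicit chart datum.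

## References

* J. Milnor, *Lectures on the h-cobordism theorem*, notes by L. Siebenmann and J. Sondow,
  Princeton Mathematical Notes (1965): Def. 3.1 (2) (PDF p. 12), Def. 3.9 (PDF p. 16), proof of
  Thm. 3.12 (PDF p. 18), Def. 4.9 (PDF p. 25). [MilnorHCobordism1965]
* R. Thom, *Quelques propriétés globales des variétés différentiables*, Comment. Math. Helv. 28
  (1954), Ch. II. [ThomCMH1954]
-/

open scoped Manifold ContDiff Topology
open Set Function Filter Metric
open Literature.AlgebraicTopology.SingularHomology

noncomputable section

namespace Literature.Topology.FourManifolds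

/-- For an index at least the dimension, Milnor's model field negates every coordinate (all
coordinates are contracting). [cite: MilnorHCobordism1965, Def. 3.1 (2) (PDF p. 12)] -/
theorem milnorModelField_eq_neg_of_le {m k : ℕ} (h : m ≤ k) (u : EuclideanSpace ℝ (Fin m)) :
    milnorModelField k u = -u := by
  ext i
  have hi : (i : ℕ) < k := lt_of_lt_of_le i.2 h
  simp [milnorModelField_apply, hi]

namespace Cobordism

variable {n : ℕ} {M N : Type} [TopologicalSpace M] [ChartedSpace (EuclideanSpace ℝ (Fin n)) M]
  [TopologicalSpace N] [ChartedSpace (EuclideanSpace ℝ (Fin n)) N]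

/-! ### The chart datum at a maximum -/

section Top

variable {c : Cobordism n M N} {g : c.W → ℝ}
  {ξ : Cₛ^∞⟮𝓡∂ (n + 1); EuclideanSpace ℝ (Fin (n + 1)), (TangentSpace (𝓡∂ (n + 1)) : c.W → Type)⟯}
  {p : c.W}

/-- **The setting at a maximum**: a Milnor box about the critical point `p` of index `n + 1` for
`(g, ξ)`, with chart domain inside `U = {g < cutLevel n (n + 2)}` and index parameter
`≥ n + 1`. [cite: MilnorHCobordism1965, Def. 3.1 (2) (PDF p. 12)] -/
structure TopSetting (c : Cobordism n M N) (g : c.W → ℝ)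
    (ξ : Cₛ^∞⟮𝓡∂ (n + 1); EuclideanSpace ℝ (Fin (n + 1)), (TangentSpace (𝓡∂ (n + 1)) : c.W → Type)⟯)
    (p : c.W) where
  /-- the Milnor box -/
  box : MilnorBox (𝓡∂ (n + 1)) g (⇑ξ) p
  /-- its chart domain lies in `U` -/
  source_subset : box.chart.source ⊆ {z : c.W | g z < cutLevel n (n + 1 + 1)}
  /-- all coordinates are contracting -/
  le_k : n + 1 ≤ box.k
  /-- `ξ` is gradient-like -/
  isGradientLike : IsGradientLike (𝓡∂ (n + 1)) g ξ
  /-- `p` is critical of index `n + 1` -/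
  mem : p ∈ criticalSetOfIndex (𝓡∂ (n + 1)) g (n + 1)
  /-- `g` is a nice Morse function -/
  nice : c.IsNiceMorseFunction g

/-- **Existence of the setting at a maximum** (Milnor boxes exist about interior critical points,
`IsGradientLike.exists_milnorBox_source_subset`; the index parameter of a box about a critical
point of index `n + 1` is `≥ n + 1`, `isMCriticalPt_and_morseIndex_eq_of_eq_milnorQuadratic`).
[cite: MilnorHCobordism1965, Def. 3.1 (2) (PDF p. 12)] -/
theorem IsNiceMorseFunction.nonempty_topSetting (hg : c.IsNiceMorseFunction g)
    (ξ : Cₛ^∞⟮𝓡∂ (n + 1); EuclideanSpace ℝ (Fin (n + 1)), (TangentSpace (𝓡∂ (n + 1)) : c.W → Type)⟯)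
    (hξ : IsGradientLike (𝓡∂ (n + 1)) g ξ) (hp : p ∈ criticalSetOfIndex (𝓡∂ (n + 1)) g (n + 1)) :
    Nonempty (TopSetting c g ξ p) := by
  have hgM := hg.isMorseFunction
  have hgs : ContMDiff (𝓡∂ (n + 1)) 𝓘(ℝ, ℝ) ∞ g := hgM.isMorse.contMDiff
  have hint : (𝓡∂ (n + 1)).IsInteriorPoint p :=
    ((𝓡∂ (n + 1)).isInteriorPoint_or_isBoundaryPoint p).resolve_right fun hb => hgM.2.2.2.1 p hb hp.1
  have hpU : p ∈ {z : c.W | g z < cutLevel n (n + 1 + 1)} := by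
    show g p < cutLevel n (n + 1 + 1)
    rw [hg.apply_eq hp.1, hp.2]
    exact niceLevel_lt_cutLevel_succ n (n + 1)
  have hO : IsOpen {z : c.W | g z < cutLevel n (n + 1 + 1)} := isOpen_lt hgs.continuous continuous_const
  obtain ⟨D, hD⟩ := hξ.exists_milnorBox_source_subset (X := ⇑ξ) hp.1 hint hO hpU fun _ _ => rfl
  have hk : min (n + 1) D.k = morseIndex (𝓡∂ (n + 1)) g p :=
    ((isMCriticalPt_and_morseIndex_eq_of_eq_milnorQuadratic (hgs.of_le (by norm_cast) p)
      D.mem_maximalAtlas D.mem_source hint D.apply_eq).2).symm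
  rw [hp.2] at hk
  have hle : n + 1 ≤ D.k := by
    rcases le_total (n + 1) D.k with h | h
    · exact h
    · rw [min_eq_right h] at hk; omega
  exact ⟨⟨D, hD, hle, hξ, hp, hg⟩⟩

namespace TopSetting

variable (S : TopSetting c g ξ p)

/-- The extended chart `φ̂`. [folklore] -/
abbrev φ : PartialEquiv c.W (EuclideanSpace ℝ (Fin (n + 1))) := S.box.chart.extend (𝓡∂ (n + 1))

include S in
/-- `p ∈ U`. [folklore] -/
theorem p_mem : p ∈ {z : c.W | g z < cutLevel n (n + 1 + 1)} := S.source_subset S.box.mem_source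

include S in
/-- `g p = niceLevel n (n + 1)`. [folklore] -/
theorem apply_p : g p = niceLevel n (n + 1) := by rw [S.nice.apply_eq S.mem.1, S.mem.2]

/-- A vector of norm `≤ 3ε` translated to `φ̂ p` lies in the chart target. [folklore] -/
theorem add_mem_target {v : EuclideanSpace ℝ (Fin (n + 1))} (hv : ‖v‖ ≤ 3 * S.box.ε) :
    S.φ p + v ∈ S.φ.target :=
  S.box.closedBall_subset (by simpa [dist_eq_norm] using hv)

/-- … and its preimage lies in the chart domain. [folklore] -/
theorem symm_add_mem_source {v : EuclideanSpace ℝ (Fin (n + 1))} (hv : ‖v‖ ≤ 3 * S.box.ε) :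
    S.φ.symm (S.φ p + v) ∈ S.box.chart.source := by
  rw [← S.box.chart.extend_source (I := 𝓡∂ (n + 1))]
  exact S.φ.map_target (S.add_mem_target hv)

/-- The coordinates of the preimage of `φ̂ p + v`. [folklore] -/
theorem coord_symm_add {v : EuclideanSpace ℝ (Fin (n + 1))} (hv : ‖v‖ ≤ 3 * S.box.ε) :
    S.box.coord (S.φ.symm (S.φ p + v)) = v := by
  rw [MilnorBox.coord, S.φ.right_inv (S.add_mem_target hv), add_sub_cancel_left]

/-- A clipped vector has norm `≤ 3ε`. [folklore] -/
theorem norm_radialClip_le_three (v : EuclideanSpace ℝ (Fin (n + 1))) :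
    ‖radialClip S.box.ε v‖ ≤ 3 * S.box.ε := by
  linarith [norm_radialClip_le S.box.eps_pos v, S.box.eps_pos]

/-- **The transverse disc**: the chart inverse `v ↦ φ̂⁻¹ (φ̂ p + clip_ε v)`, read in `U`. [cite: MilnorHCobordism1965, Def. 3.1 (2) (PDF p. 12)] -/
def mFun (v : EuclideanSpace ℝ (Fin (n + 1))) : ↥{z : c.W | g z < cutLevel n (n + 1 + 1)} :=
  ⟨S.φ.symm (S.φ p + radialClip S.box.ε v), S.source_subset (S.symm_add_mem_source (S.norm_radialClip_le_three v))⟩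

/-- The points of the transverse disc, in `W`. [folklore] -/
theorem coe_mFun (v : EuclideanSpace ℝ (Fin (n + 1))) :
    (S.mFun v : c.W) = S.φ.symm (S.φ p + radialClip S.box.ε v) := rfl

/-- `mFun 0 = p`. [folklore] -/
theorem coe_mFun_zero : (S.mFun 0 : c.W) = p := by
  rw [coe_mFun, (radialClip_eq_zero_iff S.box.eps_pos).2 rfl, add_zero]
  exact S.box.chart.extend_left_inv (I := 𝓡∂ (n + 1)) S.box.mem_source

/-- `mFun` is continuous. [folklore] -/
theorem continuous_mFun : Continuous S.mFun := by
  refine Continuous.subtype_mk ?_ _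
  have h1 : Continuous fun v : EuclideanSpace ℝ (Fin (n + 1)) => S.φ p + radialClip S.box.ε v :=
    continuous_const.add (continuous_radialClip S.box.eps_pos)
  exact (S.box.chart.continuousOn_extend_symm (I := 𝓡∂ (n + 1))).comp_continuous h1
    fun v => S.add_mem_target (S.norm_radialClip_le_three v)

/-- `mFun` is injective on `B̄(0, ε)`. [folklore] -/
theorem injOn_mFun : InjOn S.mFun (closedBall 0 S.box.ε) := by
  intro v hv w hw h
  have hv' : ‖v‖ ≤ S.box.ε := mem_closedBall_zero_iff.1 hv
  have hw' : ‖w‖ ≤ S.box.ε := mem_closedBall_zero_iff.1 hw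
  have h' : S.box.coord (S.mFun v : c.W) = S.box.coord (S.mFun w : c.W) :=
    congrArg (fun u : ↥{z : c.W | g z < cutLevel n (n + 1 + 1)} => S.box.coord (u : c.W)) h
  rw [coe_mFun, coe_mFun, S.coord_symm_add (S.norm_radialClip_le_three v),
    S.coord_symm_add (S.norm_radialClip_le_three w), radialClip_of_norm_le S.box.eps_pos hv',
    radialClip_of_norm_le S.box.eps_pos hw'] at h'
  exact h'

/-- **The chart datum at a maximum**: stratum `{p}`, neighbourhood the chart domain, coordinate
`clip_ε (φ̂ - φ̂ p)`, disc the chart inverse of radius `ε`. [cite: MilnorHCobordism1965, Def. 3.1 (2) (PDF p. 12)] -/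
def datum : TransverseDiscDatum ↥{z : c.W | g z < cutLevel n (n + 1 + 1)} (n + 1) where
  P := {⟨p, S.p_mem⟩}
  N := Subtype.val ⁻¹' S.box.chart.source
  isClosed_P := isClosed_singleton
  isOpen_N := S.box.chart.open_source.preimage continuous_subtype_val
  subset := by
    rintro u hu
    rw [mem_singleton_iff] at hu
    rw [hu]; exact S.box.mem_source
  m := S.mFun
  r := S.box.ε
  r_pos := S.box.eps_pos
  continuousOn_m := S.continuous_mFun.continuousOn
  injOn_m := S.injOn_mFun
  K := ⟨fun u => radialClip S.box.ε (S.box.coord (u : c.W)),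
    (continuous_radialClip S.box.eps_pos).comp
      (S.box.continuousOn_coord.comp_continuous (continuous_subtype_val.comp continuous_subtype_val)
        fun u => u.2)⟩
  norm_le := fun _ => norm_radialClip_le S.box.eps_pos _
  eq_zero_iff := fun u => by
    change radialClip S.box.ε (S.box.coord (u : c.W)) = 0 ↔ (u : ↥{z : c.W | g z < cutLevel n (n + 1 + 1)}) ∈ ({⟨p, S.p_mem⟩} : Set _)
    rw [radialClip_eq_zero_iff S.box.eps_pos, mem_singleton_iff, MilnorBox.coord, sub_eq_zero]
    constructor
    · intro h
      apply Subtype.ext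
      have h1 := congrArg S.φ.symm h
      rwa [S.box.chart.extend_left_inv (I := 𝓡∂ (n + 1)) u.2,
        S.box.chart.extend_left_inv (I := 𝓡∂ (n + 1)) S.box.mem_source] at h1
    · intro h
      rw [h]

/-- The centre of the datum is `p`. [folklore] -/
theorem coe_datum_m_zero : ((S.datum.m 0 : ↥{z : c.W | g z < cutLevel n (n + 1 + 1)}) : c.W) = p :=
  S.coe_mFun_zero

/-- The centre of the datum, as a point of `U`. [folklore] -/
theorem datum_m_zero : S.datum.m 0 = ⟨p, S.p_mem⟩ := Subtype.ext S.coe_datum_m_zero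

/-- **The disc lies in `N`.** [folklore] -/
theorem mapsTo_m : MapsTo S.datum.m (closedBall 0 S.datum.r) S.datum.N := fun v _ =>
  S.symm_add_mem_source (S.norm_radialClip_le_three v)

/-- **`K ∘ m = id` on `B̄(0, ε)`.** [folklore] -/
theorem K_m (v : EuclideanSpace ℝ (Fin (n + 1))) (hv : v ∈ closedBall 0 S.datum.r) :
    S.datum.K ⟨S.datum.m v, S.mapsTo_m hv⟩ = v := by
  have hv' : ‖v‖ ≤ S.box.ε := mem_closedBall_zero_iff.1 hv
  change radialClip S.box.ε (S.box.coord (S.mFun v : c.W)) = v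
  rw [coe_mFun, S.coord_symm_add (S.norm_radialClip_le_three v), radialClip_of_norm_le S.box.eps_pos hv',
    radialClip_of_norm_le S.box.eps_pos hv']

/-- **The disc lies in the stable set of `p`** (all coordinates contracting; Milnor's straight
line trajectories). [cite: MilnorHCobordism1965, proof of Thm. 3.12 (PDF p. 18)] -/
theorem disc_subset : S.datum.disc ⊆ {u | (u : c.W) ∈ stableSet (𝓡∂ (n + 1)) (⇑ξ) p} := by
  rintro _ ⟨v, -, rfl⟩
  show (S.mFun v : c.W) ∈ stableSet (𝓡∂ (n + 1)) (⇑ξ) p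
  rw [coe_mFun]
  have hε := S.box.eps_pos
  have hball : ball (S.φ p) (2 * S.box.ε) ⊆ S.φ.target :=
    (ball_subset_closedBall.trans (closedBall_subset_closedBall (by linarith))).trans S.box.closedBall_subset
  exact mem_stableSet_of_chart_milnorModelField (I := 𝓡∂ (n + 1)) (k := S.box.k) S.box.mem_maximalAtlas
    S.box.mem_source S.box.mfderiv_eq hball (milnorModelField_eq_neg_of_le S.le_k _)
    (by linarith [norm_radialClip_le hε v])

/-- **The disc is a neighbourhood of `p`** in `U` (it contains the chart preimage of the open
ball of radius `ε`). [folklore] -/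
theorem disc_mem_nhds : S.datum.disc ∈ 𝓝 (S.datum.m 0) := by
  have hε := S.box.eps_pos
  set O : Set c.W := {z | z ∈ S.box.chart.source ∧ ‖S.box.coord z‖ < S.box.ε} with hO
  have hOo : IsOpen O :=
    S.box.continuousOn_coord.isOpen_inter_preimage S.box.chart.open_source (isOpen_lt continuous_norm continuous_const)
  have hpO : ((S.datum.m 0 : ↥{z : c.W | g z < cutLevel n (n + 1 + 1)}) : c.W) ∈ O := by
    rw [S.coe_datum_m_zero]
    exact ⟨S.box.mem_source, by rw [MilnorBox.coord_self, norm_zero]; exact hε⟩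
  refine mem_of_superset ((hOo.preimage continuous_subtype_val).mem_nhds hpO) ?_
  rintro u ⟨hu, hur⟩
  refine ⟨S.box.coord (u : c.W), mem_closedBall_zero_iff.2 hur.le, Subtype.ext ?_⟩
  show (S.mFun (S.box.coord (u : c.W)) : c.W) = u
  rw [coe_mFun, radialClip_of_norm_le hε hur.le]
  exact S.box.symm_add_coord hu

include S in
/-- **The chart detection datum at a maximum** (with a collapse map of it, which exists because
`U` is metrisable). [cite: MilnorHCobordism1965, Def. 3.1 (2), Def. 3.9 (PDF pp. 12, 16)] [cite: ThomCMH1954, Ch. II] -/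
theorem nonempty_detectionDatum : Nonempty (DetectionDatum c g (⇑ξ) (n + 1) p) := by
  haveI : TopologicalSpace.MetrizableSpace c.W := TopologicalSpace.metrizableSpace_of_t3_secondCountable _
  obtain ⟨γ, V, hV, hPV, -, hγV, hγP⟩ := S.datum.exists_collapse
  have hv : ContMDiff (𝓡∂ (n + 1)) (𝓡∂ (n + 1)).tangent 1
      (fun y ↦ (⟨y, ξ y⟩ : TangentBundle (𝓡∂ (n + 1)) c.W)) :=
    ξ.contMDiff.of_le (WithTop.coe_le_coe.mpr le_top)
  refine ⟨⟨S.datum, γ, V, hV, hPV, hγV, hγP, S.mapsTo_m, S.K_m, S.coe_datum_m_zero, S.disc_subset,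
    mem_nhdsWithin_of_mem_nhds S.disc_mem_nhds, ?_, ?_, ?_⟩⟩
  · -- `D_L(p) ∩ {p} = {p}`
    intro u _ huP
    rw [S.datum_m_zero]
    exact mem_singleton_iff.1 huP
  · -- the stratum misses `{g ≤ cutLevel n (n + 1)}`
    intro u hu huP
    have h : u = ⟨p, S.p_mem⟩ := mem_singleton_iff.1 huP
    rw [h] at hu
    have h1 : g p = niceLevel n (n + 1) := S.apply_p
    have h2 := cutLevel_lt_niceLevel n (n + 1)
    have hu' : g p ≤ cutLevel n (n + 1) := hu
    linarith
  · -- the stratum misses the stable sets of the other critical points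
    intro p' _ hne u hu huP
    have h : u = ⟨p, S.p_mem⟩ := mem_singleton_iff.1 huP
    rw [h] at hu
    have h0 : ξ p = 0 := S.isGradientLike.apply_eq_zero_of_isMCriticalPt S.mem.1
    exact hne (eq_of_mem_stableSet_of_apply_eq_zero hv h0 hu)

end TopSetting

/-- **Detection data exist at every critical point of index `n + 1`** of a nice Morse function
with a smooth gradient-like field. [cite: MilnorHCobordism1965, Def. 3.1 (2), Def. 3.9 (PDF pp. 12, 16)] [cite: ThomCMH1954, Ch. II] -/
theorem IsNiceMorseFunction.nonempty_detectionDatum_top (hg : c.IsNiceMorseFunction g)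
    (ξ : Cₛ^∞⟮𝓡∂ (n + 1); EuclideanSpace ℝ (Fin (n + 1)), (TangentSpace (𝓡∂ (n + 1)) : c.W → Type)⟯)
    (hξ : IsGradientLike (𝓡∂ (n + 1)) g ξ) (hp : p ∈ criticalSetOfIndex (𝓡∂ (n + 1)) g (n + 1)) :
    Nonempty (DetectionDatum c g (⇑ξ) (n + 1) p) := by
  obtain ⟨S⟩ := hg.nonempty_topSetting ξ hξ hp
  exact S.nonempty_detectionDatum

/-- **Detection data exist at every critical point of index `k ≤ n + 1`** of a nice Morse
function with a smooth gradient-like field (right-hand disc data for `k ≤ n`, chart data for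
`k = n + 1`). [cite: MilnorHCobordism1965, Def. 3.1 (2), Def. 3.9, Lemma 6.3, Lemma 7.2] [cite: ThomCMH1954, Ch. II] -/
theorem IsNiceMorseFunction.nonempty_detectionDatum (hg : c.IsNiceMorseFunction g)
    (ξ : Cₛ^∞⟮𝓡∂ (n + 1); EuclideanSpace ℝ (Fin (n + 1)), (TangentSpace (𝓡∂ (n + 1)) : c.W → Type)⟯)
    (hξ : IsGradientLike (𝓡∂ (n + 1)) g ξ) {k : ℕ} (hk : k ≤ n + 1) (hp : p ∈ criticalSetOfIndex (𝓡∂ (n + 1)) g k) :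
    Nonempty (DetectionDatum c g (⇑ξ) k p) := by
  rcases Nat.lt_or_ge k (n + 1) with h | h
  · exact HandleNormalDatum.nonempty_detectionDatum hg ξ hξ (by omega) hp
  · obtain rfl : k = n + 1 := le_antisymm hk h
    exact hg.nonempty_detectionDatum_top ξ hξ hp

end Top

end Cobordism

end Literature.Topology.FourManifolds

end
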